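import Summits.ResolutionOfSingularities.ResolutionOfSingularities.Theorems.MarkedTransferCampaignW46PlaneInvariant
import HarnessLib

/-!
# [OURS · L1 W4.6 rung (i-e)] DIVISORIAL RUNS TERMINATE IN EVERY DIMENSION — the dimension-free part of the surface
# argument (cell res-hironaka, LADDER-RESOLUTION rung L, D-0089; campaign s46, prover res-L1-s46-pv-1; host route
# MarkedTransfer, `--supports stmt-ResolutionOfSingularities-16155`)

HONEST FRAMING. Nothing here is a statement of H. Hironaka's manuscript (2017-03-23, [Hironaka2017]) and nothing here
asserts that any statement of it holds. Everything is OURS or pure logic over this campaign's résumé-free reduction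
(`PermissibleRun`, p469934) and typed procedure (`RunNabla`/`TerminatesNabla`, res-L1-type-o1). AI-written; weaker than
expert review. No `sorry`; axioms standard.

## What this file records

The surface proofs of rungs (i-b)/(i-d) split a §2.1-permissible step by the codimension of its centre. The DIVISORIAL half
— centre `D` whose generic point has codimension one in `Z` (a regular curve on a surface, a regular surface in a
threefold, …) — uses nothing about surfaces: the blow-up along a regular prime divisor of a regular scheme is an
isomorphism, the transform is `J′ ≅ (J : 𝓘_D^b)`, the order drops by at least `b` at every point of `D`
(`idealOrder_transform_lt_of_divisorialCentre`, p529691) and the divisorial sum `Σ_ζ ord_ζ J` over the codimension-one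
points of `V(J)` drops (`divisorialSum_transform_lt_of_curveCentre`, p523993 — its hypotheses are dimension-free). Hence,
in EVERY dimension and over EVERY field `K : Type u` of characteristic `p`:

* `IsDivisorialCentre D` — the generic point of the (irreducible closed) centre `D` has codimension one;
* **`PermissibleRun.false_of_forall_isDivisorialCentre`** — RUNG (i-e), résumé-free: there is no infinite §2.1-permissible
  sequence of standard ideal exponents all of whose centres are divisorial;
  `PermissibleRun.exists_not_isDivisorialCentre_ge` — so every infinite permissible sequence has, beyond every stage, a
  step whose centre has codimension `≥ 2`;
* typed, for EVERY notion instance `N`, reading `Rd` and regime `Rg`: `Resumes.DivisorialPlats N Rd Rg` (every component of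
  every terminal plat `∇(E)` of a state in `Rg` is a divisor of `Z`) implies `TerminatesNabla N Rd Rg`
  (`terminatesNabla_of_divisorialPlats`) — the ∇-centred typed Th. 16.6 procedure terminates in any regime where the
  résumés' plats are hypersurfaces, whatever the dimension. A narrow class, recorded because it is the exact
  dimension-free content of the surface rungs; the codimension-`≥ 2` centres are where dimension enters (rung (i-b)'s
  point steps use Zariski's two-dimensional quadratic-transform finiteness).

## References

* V. Cossart, O. Piltant, J. Algebra 320 (2008), proof of Prop. 4.2 (divisorial bookkeeping). [CossartPiltant2008]
* H. Hironaka, ms. 2017-03-23, Th. 16.6 (4) p.84 l.29, Th. 16.13 p.87 l.26–28 — the ROLE context only, under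
  adjudication, not cited as fact. [Hironaka2017]
-/

noncomputable section

set_option linter.dupNamespace false -- mandated namespace of this single-conjunct summit

open CategoryTheory AlgebraicGeometry TopologicalSpace

namespace Summit.ResolutionOfSingularities.ResolutionOfSingularities.Theorems

namespace CampaignW46

open Literature.AlgebraicGeometry.Resolution
open Literature.AlgebraicGeometry.Hironaka2017.S02Preliminaries
open Literature.AlgebraicGeometry.Hironaka2017.Datum
open Scheme.IdealSheafData

universe u

variable {p : ℕ} [Fact p.Prime] {K : Type u} [Field K] [CharP K p]

/-! ## Divisorial centres -/

/-- [OURS · L1 W4.6 rung (i-e)] NOT a statement of the manuscript. **The centre `D` is DIVISORIAL**: some generic point of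
`D` has codimension one in the ambient scheme (`Order.coheight η = 1`; for an irreducible closed `D` on a regular `Z`:
`D` is a prime divisor). [folklore] -/
def IsDivisorialCentre {Z : Scheme.{u}} (D : Closeds Z) : Prop :=
  ∃ η : Z, IsGenericPoint η (D : Set Z) ∧ Order.coheight η = 1

/-- **At a divisorial step the divisorial sum drops** (any dimension): restatement of
`divisorialSum_transform_lt_of_curveCentre` through `IsDivisorialCentre`. [cite: CossartPiltant2008, proof of Prop. 4.2] -/
theorem divisorialSum_transform_lt_of_isDivisorialCentre (A A' : AmbientDatum p K) (E : IdealExponent A.Z)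
    (hE : E.IsStandard) {D : Closeds A.Z} (hD : E.IsPermissibleCentre A.hom D) (hdiv : IsDivisorialCentre D)
    {π : A'.Z ⟶ A.Z} (hπ : IsBlowup π (vanishingIdeal D)) (hE' : (E.transform π D).IsStandard) :
    divisorialSum (E.transform π D).J < divisorialSum E.J := by
  obtain ⟨η, hη, hcoh⟩ := hdiv
  exact divisorialSum_transform_lt_of_curveCentre A A' E hE hD hη hcoh hπ hE'

/-- **At a divisorial step OUR per-point invariant obeys the (127)/(128)-roles in every dimension** (order component drops
by `≥ b` on the centre, `looseGermMeasure`-free statement): `ord_{y′} J′ < ord_{π y′} J` over the centre and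
`ord_{y′} J′ = ord_{π y′} J` off it. [folklore] -/
theorem idealOrder_laws_of_isDivisorialCentre (A A' : AmbientDatum p K) (E : IdealExponent A.Z) (hE : E.IsStandard)
    {D : Closeds A.Z} (hD : E.IsPermissibleCentre A.hom D) (hdiv : IsDivisorialCentre D) {π : A'.Z ⟶ A.Z}
    (hπ : IsBlowup π (vanishingIdeal D)) :
    (∀ y' : A'.Z, π y' ∈ (D : Set A.Z) → idealOrder (E.transform π D).J y' < idealOrder E.J (π y')) ∧
      (∀ y' : A'.Z, π y' ∉ (D : Set A.Z) → idealOrder (E.transform π D).J y' = idealOrder E.J (π y')) := by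
  obtain ⟨η, hη, hcoh⟩ := hdiv
  exact ⟨fun y' hy => idealOrder_transform_lt_of_divisorialCentre A A' E hE hD hη hcoh hπ hy,
    fun y' hy => idealOrder_transform_of_not_mem hπ E hy⟩

/-! ## Rung (i-e): divisorial runs terminate, in every dimension -/

namespace PermissibleRun

/-- [OURS · L1 W4.6 rung (i-e)] NOT a statement of the manuscript. **RUNG (i-e) — NO INFINITE §2.1-PERMISSIBLE SEQUENCE HAS
ONLY DIVISORIAL CENTRES**, in every dimension and over every field `K : Type u` of characteristic `p`: the divisorial sum
`Σ_ζ ord_ζ J ∈ ℕ` drops at every step. Replaces the role of the termination clause of Th. 16.13 p.87 l.26–28 for the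
steps of the procedure whose centres are hypersurfaces of the ambient scheme. [folklore] -/
theorem false_of_forall_isDivisorialCentre (r : PermissibleRun p K) (h : ∀ k, IsDivisorialCentre (r.D k)) : False := by
  have hlt : ∀ k, divisorialSum (r.E (k + 1)).J < divisorialSum (r.E k).J := by
    intro k
    have hE' := r.standard (k + 1)
    rw [r.E_succ k] at hE' ⊢
    exact divisorialSum_transform_lt_of_isDivisorialCentre (r.A k) (r.A (k + 1)) (r.E k) (r.standard k)
      (r.permissible k) (h k) (r.blowup k) hE'
  exact (wellFounded_iff_isEmpty_descending_chain.mp (wellFounded_lt (α := ℕ))).false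
    ⟨fun k => divisorialSum (r.E k).J, hlt⟩

/-- [OURS · L1 W4.6 rung (i-e)] NOT a statement of the manuscript. Hence every infinite §2.1-permissible sequence has,
beyond every stage, a step whose centre is NOT divisorial (codimension `≥ 2`: a point on a surface, a point or a curve on
a threefold, …). [folklore] -/
theorem exists_not_isDivisorialCentre_ge (r : PermissibleRun p K) (k₀ : ℕ) :
    ∃ k, k₀ ≤ k ∧ ¬ IsDivisorialCentre (r.D k) := by
  by_contra hcon
  push Not at hcon
  refine (r.drop k₀).false_of_forall_isDivisorialCentre fun k => ?_
  have key : ∀ j k, IsDivisorialCentre (r.D (k + j)) → IsDivisorialCentre ((r.drop j).D k) := by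
    intro j
    induction j with
    | zero => exact fun k hk => hk
    | succ j ih =>
      intro k hk
      change IsDivisorialCentre (((r.drop j).tail).D k)
      exact ih (k + 1) (by rw [show k + 1 + j = k + (j + 1) by omega]; exact hk)
  exact key k₀ k (hcon (k + k₀) (Nat.le_add_left k₀ k))

end PermissibleRun

/-! ## Typed corollary: plats that are divisors -/

variable {n : ℕ}

/-- [OURS · L1 W4.6 rung (i-e)] NOT a statement of the manuscript. **The résumés read by `Rd` have DIVISORIAL PLATS in the
regime `Rg`**: for every state `(A, E)` in `Rg` and every résumé `R` of `E` read by `Rd`, every irreducible component of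
the terminal plat `∇(E)` (`IsNablaComponent`, DESIGN POINT (CMP)) is a divisor of `Z` (`IsDivisorialCentre`). A hypothesis
CLASS on the notion instance (VACUITY as (VAC) of the typed-procedure module: contentful exactly for named instances).
[folklore] -/
def Resumes.DivisorialPlats (N : Notions.{u} n) (Rd : Reading p K N) (Rg : Regime p K) : Prop :=
  ∀ (A : AmbientDatum p K) (E : IdealExponent A.Z) (R : Resume N A E), Rd A E R → Rg A E →
    ∀ D : Closeds A.Z, IsNablaComponent R D → IsDivisorialCentre D

/-- [OURS · L1 W4.6 rung (i-e), typed] NOT a statement of the manuscript. **The ∇-centred typed Th. 16.6 procedure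
terminates in every regime in which the plats are divisors**, for EVERY notion instance `N`, reading `Rd`, regime `Rg`,
in every dimension and over every field `K : Type u` of characteristic `p`. [folklore] -/
theorem terminatesNabla_of_divisorialPlats {N : Notions.{u} n} {Rd : Reading p K N} {Rg : Regime p K}
    (h : Resumes.DivisorialPlats N Rd Rg) : TerminatesNabla N Rd Rg :=
  fun r hr => r.toRun.toPermissibleRun.false_of_forall_isDivisorialCentre fun k =>
    h (r.A k) (r.E k) (r.R k) (r.reads k) (hr k) (r.step k).toStep.D (r.step k).component

end CampaignW46

end Summit.ResolutionOfSingularities.ResolutionOfSingularities.Theorems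

end
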